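import Summits.QuantumFields.YangMills.Theorems.SwapTwistDeficitPeriodicRingFloorToronBox
import Summits.QuantumFields.YangMills.Theorems.FlatTubeReductionPolyakovPairSeparation
import HarnessLib

/-!
# The NEARLY-COMMUTING toron box of the zero-flux ring: the action deficit is `O_L((t₂ + s)²)` when the four leaders merely
# commute up to `s` (no smallness of the leaders) — the action half of the LOGARITHMIC periodic floor at fixed `L`
# (free-hands support of item stmt-QuantumFields-24497 `ToronValleyVolume.ToronTubeVolumeLaw`, its one-sided fixed-`L` half; sequel of
# ✓`SwapTwistDeficitPeriodicRingFloorToronBox`, brick (A1-i) of the fixed-`L` reduction memo of seat w2 g54)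

In ✓`PeriodicRingFloor.ringDeficit_le_of_toronBox` the four leaders — the wrap links `C_μ = w(−ê_μ, μ)` of slice `0` and the seam value `c = g 0` —
were `t₁`-close to `1`, which was used only through their commutators (`‖C_μC_ν − C_νC_μ‖ ≤ 2t₁²`, `‖cUc⁻¹ − U‖ ≤ 2t₁‖U − 1‖`).  Here the leaders are
arbitrary elements of `SU(2)` that PAIRWISE NEARLY COMMUTE (`‖C_μC_ν − C_νC_μ‖_F ≤ s`, `‖cC_μ − C_μc‖_F ≤ s`); every other variable is, as before,
`t₂`-close to its letter.  The set of nearly commuting quadruples has Haar⁴-volume `≍ s⁶·log s⁻¹` (the commuting-holonomy cone; seat w2 g54's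
`ToronLog`), against `t₁¹² = s⁶` for the small box: this is where the logarithm of the periodic toron valley (RLCT `9L⁴ − 3/2`, multiplicity `2`) lives.

* §1 `norm_rho_plaquetteWord_sub_one_le_comm` (the word lemma of ✓`TwistExponentGap.ToronFloor` with the commutator term kept as
  `‖ρ(CᵢCⱼCᵢ⁻¹Cⱼ⁻¹) − 1‖`), `frobNorm_plaquetteHolonomy_sub_one_le_of_commBox` (plaquettes within `4t₂ + s`), `wilsonAction_le_of_commBox`;
* §2 `frobNorm_gaugeTransform_sub_le_of_commSeam` — the seam transformation moves a link `t₂`-close to its letter by `≤ 4t₂ + s`;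
* §3 ★ `ringDeficit_le_of_commBox` — `F₀(glue w ∷ r, g) ≤ 250·L⁴·(t₂ + s)²` on the nearly-commuting box.

HONEST FRAMING: fixed-lattice Frobenius-norm bookkeeping ([cite: Luscher1983, §2]; [cite: Vanbaal2001]; [cite: GonzalezarroyoAltes1988]); ⟨24497⟩ (a TWO-sided,
`poly(L)`-uniform volume law) is NOT proved, nor any crux, rung or summit; the Yang–Mills mass gap is NOT proved; no summit is proved by a line.
THEOREMS ONLY (0 `def`, 0 `sorry`), standard axioms.  Width seat ym-line-sfw-p2-w3 g61 (cell ym-idea-1, free hands), `--supports stmt-QuantumFields-24497`.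
-/

set_option autoImplicit false

noncomputable section

open MeasureTheory
open scoped BigOperators Matrix.Norms.Frobenius
open Literature.MathematicalPhysics.QuantumFieldTheory hiding SU2
open Literature.MathematicalPhysics.QuantumLattice
open Summit.QuantumFields.YangMills.Theorems.FemtoTransferGap
open Summit.QuantumFields.YangMills.Theorems.FemtoTransferGap.TT
open Summit.QuantumFields.YangMills.Theorems.VirialFluxGap.RingDeficit
open Summit.QuantumFields.YangMills.Theorems.ToronValleyVolume.Lojasiewicz (ringDeficit_eq_sums)
open Summit.QuantumFields.YangMills.Theorems.TwistExponentGap.ToronFloor (norm_insert_letter)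
open Summit.QuantumFields.YangMills.Theorems.FemtoCurvatureTwoPoint.DoublingOfRV (sub_re_trace_le norm_rho_inv_sub_one)

namespace Summit.QuantumFields.YangMills.Theorems.SwapTwistDeficit.PeriodicRingFloor

variable {L : ℕ} [NeZero L]

/-! ## §1 Plaquettes and the Wilson action on the nearly-commuting box -/

section Algebra

variable {G : Type*} [Group G] {N : ℕ} (ρ : G →* Matrix (Fin N) (Fin N) ℂ)
  (hU : ∀ g, ρ g ∈ Matrix.unitaryGroup (Fin N) ℂ)

include hU in
/-- **The plaquette word around two seam letters, commutator form**: for letters `Cᵢ, Cⱼ` and fluctuations `a, b, a', b'`,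
`‖ρ((Cᵢa)(Cⱼb)(Cᵢa')⁻¹(Cⱼb')⁻¹) − 1‖ ≤ ‖ρa−1‖ + ‖ρb−1‖ + ‖ρa'−1‖ + ‖ρb'−1‖ + ‖ρ(CᵢCⱼCᵢ⁻¹Cⱼ⁻¹) − 1‖` (✓`norm_rho_plaquetteWord_sub_one_le` with the
commutator not yet estimated). [cite: Balaban1985Averaging, (19) p.21] -/
theorem norm_rho_plaquetteWord_sub_one_le_comm (Ci Cj a b a' b' : G) :
    ‖ρ (Ci * a * (Cj * b) * (Ci * a')⁻¹ * (Cj * b')⁻¹) - 1‖ ≤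
      ‖ρ a - 1‖ + ‖ρ b - 1‖ + ‖ρ a' - 1‖ + ‖ρ b' - 1‖ + ‖ρ (Ci * Cj * Ci⁻¹ * Cj⁻¹) - 1‖ := by
  set r₁ : G := Cj * b * a'⁻¹ * Ci⁻¹ * b'⁻¹ * Cj⁻¹ with hr₁
  set r₂ : G := a'⁻¹ * Ci⁻¹ * b'⁻¹ * Cj⁻¹ with hr₂
  set r₃ : G := Ci⁻¹ * b'⁻¹ * Cj⁻¹ with hr₃
  have hw0 : ρ (Ci * a * (Cj * b) * (Ci * a')⁻¹ * (Cj * b')⁻¹) = ρ Ci * (ρ a * ρ r₁) := by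
    rw [← map_mul, ← map_mul]; congr 1; rw [hr₁]; group
  have hw1 : ρ Ci * ρ r₁ = ρ (Ci * Cj) * (ρ b * ρ r₂) := by
    rw [← map_mul, ← map_mul, ← map_mul]; congr 1; rw [hr₁, hr₂]; group
  have hr23 : r₂ = a'⁻¹ * r₃ := by rw [hr₂, hr₃]; group
  have hw2 : ρ (Ci * Cj) * ρ r₂ = ρ (Ci * Cj) * (ρ a'⁻¹ * ρ r₃) := by
    congr 1; rw [hr23, map_mul]
  have hw3 : ρ (Ci * Cj) * ρ r₃ = ρ (Ci * Cj * Ci⁻¹) * (ρ b'⁻¹ * ρ Cj⁻¹) := by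
    rw [← map_mul, ← map_mul, ← map_mul]; congr 1; rw [hr₃]; group
  have hw4 : ρ (Ci * Cj * Ci⁻¹) * ρ Cj⁻¹ = ρ (Ci * Cj * Ci⁻¹ * Cj⁻¹) := by rw [← map_mul]
  have d1 : ‖ρ Ci * (ρ a * ρ r₁) - ρ Ci * ρ r₁‖ = ‖ρ a - 1‖ := norm_insert_letter ρ hU _ _ _
  have d2 : ‖ρ (Ci * Cj) * (ρ b * ρ r₂) - ρ (Ci * Cj) * ρ r₂‖ = ‖ρ b - 1‖ := norm_insert_letter ρ hU _ _ _
  have d3 : ‖ρ (Ci * Cj) * (ρ a'⁻¹ * ρ r₃) - ρ (Ci * Cj) * ρ r₃‖ = ‖ρ a' - 1‖ := by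
    rw [norm_insert_letter ρ hU, norm_rho_inv_sub_one ρ hU]
  have d4 : ‖ρ (Ci * Cj * Ci⁻¹) * (ρ b'⁻¹ * ρ Cj⁻¹) - ρ (Ci * Cj * Ci⁻¹) * ρ Cj⁻¹‖ = ‖ρ b' - 1‖ := by
    rw [norm_insert_letter ρ hU, norm_rho_inv_sub_one ρ hU]
  rw [hw0]
  calc ‖ρ Ci * (ρ a * ρ r₁) - 1‖
      ≤ ‖ρ Ci * (ρ a * ρ r₁) - ρ Ci * ρ r₁‖ + ‖ρ Ci * ρ r₁ - 1‖ := norm_sub_le_norm_sub_add_norm_sub _ _ _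
    _ ≤ ‖ρ a - 1‖ + (‖ρ b - 1‖ + (‖ρ a' - 1‖ + (‖ρ b' - 1‖ + ‖ρ (Ci * Cj * Ci⁻¹ * Cj⁻¹) - 1‖))) := by
        rw [d1]
        refine add_le_add le_rfl ?_
        rw [hw1]
        calc ‖ρ (Ci * Cj) * (ρ b * ρ r₂) - 1‖
            ≤ ‖ρ (Ci * Cj) * (ρ b * ρ r₂) - ρ (Ci * Cj) * ρ r₂‖ + ‖ρ (Ci * Cj) * ρ r₂ - 1‖ :=
              norm_sub_le_norm_sub_add_norm_sub _ _ _
          _ ≤ ‖ρ b - 1‖ + (‖ρ a' - 1‖ + (‖ρ b' - 1‖ + ‖ρ (Ci * Cj * Ci⁻¹ * Cj⁻¹) - 1‖)) := by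
              rw [d2]
              refine add_le_add le_rfl ?_
              rw [hw2]
              calc ‖ρ (Ci * Cj) * (ρ a'⁻¹ * ρ r₃) - 1‖
                  ≤ ‖ρ (Ci * Cj) * (ρ a'⁻¹ * ρ r₃) - ρ (Ci * Cj) * ρ r₃‖ + ‖ρ (Ci * Cj) * ρ r₃ - 1‖ :=
                    norm_sub_le_norm_sub_add_norm_sub _ _ _
                _ ≤ ‖ρ a' - 1‖ + (‖ρ b' - 1‖ + ‖ρ (Ci * Cj * Ci⁻¹ * Cj⁻¹) - 1‖) := by
                    rw [d3]
                    refine add_le_add le_rfl ?_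
                    rw [hw3]
                    calc ‖ρ (Ci * Cj * Ci⁻¹) * (ρ b'⁻¹ * ρ Cj⁻¹) - 1‖
                        ≤ ‖ρ (Ci * Cj * Ci⁻¹) * (ρ b'⁻¹ * ρ Cj⁻¹) - ρ (Ci * Cj * Ci⁻¹) * ρ Cj⁻¹‖ +
                            ‖ρ (Ci * Cj * Ci⁻¹) * ρ Cj⁻¹ - 1‖ := norm_sub_le_norm_sub_add_norm_sub _ _ _
                      _ ≤ ‖ρ b' - 1‖ + ‖ρ (Ci * Cj * Ci⁻¹ * Cj⁻¹) - 1‖ := by rw [d4, hw4]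
    _ = _ := by ring

end Algebra

/-- The commutator distance `‖ρ(xyx⁻¹y⁻¹) − 1‖` is the Frobenius norm of `xy − yx`. [folklore] -/
theorem norm_su2Rep_commutator_eq (x y : SU2) :
    ‖su2Rep (x * y * x⁻¹ * y⁻¹) - 1‖ =
      frobNorm (((x * y : SU2) : Matrix (Fin 2) (Fin 2) ℂ) - ((y * x : SU2) : Matrix (Fin 2) (Fin 2) ℂ)) := by
  rw [norm_su2Rep_sub_one, frobNorm_sub_eq_mul_inv (x * y) (y * x), mul_inv_rev]
  congr 2; group

omit [NeZero L] in
/-- ★ **Plaquettes in the nearly-commuting box (d = 3)**: letters `C : Fin 3 → SU(2)` with pairwise commutators `‖C_μC_ν − C_νC_μ‖_F ≤ s` and links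
`t₂`-close to their letters (`‖letter⁻¹·V(x,μ) − 1‖_F ≤ t₂`) force every plaquette holonomy within `4t₂ + s` of `1`. [cite: Luscher1983, §2] -/
theorem frobNorm_plaquetteHolonomy_sub_one_le_of_commBox (V : GaugeConfig 3 L SU2) (C : Fin 3 → SU2) {s t₂ : ℝ} (hs : 0 ≤ s)
    (hCC : ∀ μ ν, frobNorm (((C μ * C ν : SU2) : Matrix (Fin 2) (Fin 2) ℂ) - ((C ν * C μ : SU2) : Matrix (Fin 2) (Fin 2) ℂ)) ≤ s)
    (hV : ∀ e : Edge 3 L, frobNorm ((((if e.1 e.2 = -1 then C e.2 else 1)⁻¹ * V e : SU2) : Matrix (Fin 2) (Fin 2) ℂ) - 1) ≤ t₂)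
    (x : Site 3 L) {i j : Fin 3} (hij : i ≠ j) :
    frobNorm (((plaquetteHolonomy V x i j : SU2) : Matrix (Fin 2) (Fin 2) ℂ) - 1) ≤ 4 * t₂ + s := by
  set Cf : Edge 3 L → SU2 := fun e => if e.1 e.2 = -1 then C e.2 else 1 with hCf
  have hCfC : ∀ e e' : Edge 3 L, ‖su2Rep (Cf e * Cf e' * (Cf e)⁻¹ * (Cf e')⁻¹) - 1‖ ≤ s := by
    intro e e'
    rw [norm_su2Rep_commutator_eq]
    simp only [hCf]
    split_ifs
    · exact hCC _ _
    · simp [frobNorm_zero, hs]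
    · simp [frobNorm_zero, hs]
    · simp [frobNorm_zero, hs]
  have hV' : ∀ e : Edge 3 L, ‖su2Rep ((Cf e)⁻¹ * V e) - 1‖ ≤ t₂ := fun e => by rw [norm_su2Rep_sub_one]; exact hV e
  have hshift_i : Cf (x.shift j, i) = Cf (x, i) := by simp only [hCf, shift_apply_of_ne₃ x hij]
  have hshift_j : Cf (x.shift i, j) = Cf (x, j) := by simp only [hCf, shift_apply_of_ne₃ x hij.symm]
  have hsplit : ∀ e, V e = Cf e * ((Cf e)⁻¹ * V e) := fun e => (mul_inv_cancel_left _ _).symm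
  rw [← norm_su2Rep_sub_one]
  unfold plaquetteHolonomy
  rw [hsplit (x, i), hsplit (x.shift i, j), hsplit (x.shift j, i), hsplit (x, j), hshift_i, hshift_j]
  refine (norm_rho_plaquetteWord_sub_one_le_comm su2Rep su2_mem_unitaryGroup _ _ _ _ _ _).trans ?_
  have h1 := hV' (x, i)
  have h2 := hV' (x.shift i, j)
  have h3 := hV' (x.shift j, i)
  have h4 := hV' (x, j)
  rw [hshift_j] at h2
  rw [hshift_i] at h3
  linarith [h1, h2, h3, h4, hCfC (x, i) (x, j)]

/-- ★ The nearly-commuting box forces a small spatial Wilson action: `S(V) ≤ 3L³·(4t₂ + s)²/2`. [cite: Luscher1983, §2] -/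
theorem wilsonAction_le_of_commBox (V : GaugeConfig 3 L SU2) (C : Fin 3 → SU2) {s t₂ : ℝ} (hs : 0 ≤ s)
    (hCC : ∀ μ ν, frobNorm (((C μ * C ν : SU2) : Matrix (Fin 2) (Fin 2) ℂ) - ((C ν * C μ : SU2) : Matrix (Fin 2) (Fin 2) ℂ)) ≤ s)
    (hV : ∀ e : Edge 3 L, frobNorm ((((if e.1 e.2 = -1 then C e.2 else 1)⁻¹ * V e : SU2) : Matrix (Fin 2) (Fin 2) ℂ) - 1) ≤ t₂) :
    wilsonAction su2Rep V ≤ 3 * (L : ℝ) ^ 3 * ((4 * t₂ + s) ^ 2 / 2) := by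
  unfold wilsonAction
  calc ∑ p : Plaquette 3 L, (((2 : ℕ) : ℝ) - (su2Rep (plaquetteHolonomy V p.1 p.2.1.1 p.2.1.2)).trace.re)
      ≤ ∑ _p : Plaquette 3 L, (4 * t₂ + s) ^ 2 / 2 := Finset.sum_le_sum fun p _ =>
        sub_re_trace_le su2Rep su2_mem_unitaryGroup _ (by
          rw [norm_su2Rep_sub_one]
          exact frobNorm_plaquetteHolonomy_sub_one_le_of_commBox V C hs hCC hV p.1 (ne_of_lt p.2.2))
    _ = 3 * (L : ℝ) ^ 3 * ((4 * t₂ + s) ^ 2 / 2) := by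
        rw [Finset.sum_const, Finset.card_univ, FemtoTransferGap.card_plaquette_three L, nsmul_eq_mul]
        push_cast; ring

/-! ## §2 The seam bond on the nearly-commuting box -/

/-- The conjugation defect is the commutator: `‖cAc⁻¹ − A‖_F = ‖cA − Ac‖_F`. [folklore] -/
theorem frobNorm_conj_sub_self (c A : SU2) :
    frobNorm (((c * A * c⁻¹ : SU2) : Matrix (Fin 2) (Fin 2) ℂ) - (A : Matrix (Fin 2) (Fin 2) ℂ)) =
      frobNorm (((c * A : SU2) : Matrix (Fin 2) (Fin 2) ℂ) - ((A * c : SU2) : Matrix (Fin 2) (Fin 2) ℂ)) := by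
  rw [frobNorm_sub_eq_mul_inv, frobNorm_sub_eq_mul_inv (c * A) (A * c), mul_inv_rev]
  congr 2; group

omit [NeZero L] in
/-- **The seam transformation on the nearly-commuting box**: if every `g x` is `t₂`-close to `c = g 0`, `c` commutes with every letter up to `s`
(`‖c·ℓ_e − ℓ_e·c‖_F ≤ s`), and the link `U e` is `t₂`-close to its letter `ℓ_e`, then `‖(g·U) e − U e‖_F ≤ 4t₂ + s`
(`g_xUg_y⁻¹ ≈ cUc⁻¹ ≈ cℓc⁻¹ ≈ ℓ ≈ U`). [cite: Luscher1983, §2] -/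
theorem frobNorm_gaugeTransform_sub_le_of_commSeam {t₂ s : ℝ} {g : Site 3 L → SU2} {U : GaugeConfig 3 L SU2} (ℓ : Edge 3 L → SU2)
    (hg : ∀ x, frobNorm ((((g 0)⁻¹ * g x : SU2) : Matrix (Fin 2) (Fin 2) ℂ) - 1) ≤ t₂)
    (hcomm : ∀ e, frobNorm (((g 0 * ℓ e : SU2) : Matrix (Fin 2) (Fin 2) ℂ) - ((ℓ e * g 0 : SU2) : Matrix (Fin 2) (Fin 2) ℂ)) ≤ s)
    (hU : ∀ e, frobNorm ((U e : Matrix (Fin 2) (Fin 2) ℂ) - (ℓ e : Matrix (Fin 2) (Fin 2) ℂ)) ≤ t₂) (e : Edge 3 L) :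
    frobNorm (((gaugeTransform g U e : SU2) : Matrix (Fin 2) (Fin 2) ℂ) - (U e : Matrix (Fin 2) (Fin 2) ℂ)) ≤ 4 * t₂ + s := by
  set c : SU2 := g 0 with hc
  have hgx : ∀ x, frobNorm ((g x : Matrix (Fin 2) (Fin 2) ℂ) - (c : Matrix (Fin 2) (Fin 2) ℂ)) ≤ t₂ := fun x => by
    rw [← frobNorm_inv_mul_sub_one]; exact hg x
  have h1 := frobNorm_sandwich_sub_sandwich_le (g e.1) (g (e.1.shift e.2)) c (U e)
  have h2 : frobNorm (((c * U e * c⁻¹ : SU2) : Matrix (Fin 2) (Fin 2) ℂ) - ((c * ℓ e * c⁻¹ : SU2) : Matrix (Fin 2) (Fin 2) ℂ)) ≤ t₂ := by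
    rw [TwoLattice.ConstTube.frobNorm_conj_sub_conj]; exact hU e
  have h3 : frobNorm (((c * ℓ e * c⁻¹ : SU2) : Matrix (Fin 2) (Fin 2) ℂ) - (ℓ e : Matrix (Fin 2) (Fin 2) ℂ)) ≤ s := by
    rw [frobNorm_conj_sub_self]; exact hcomm e
  have h4 : frobNorm ((ℓ e : Matrix (Fin 2) (Fin 2) ℂ) - (U e : Matrix (Fin 2) (Fin 2) ℂ)) ≤ t₂ := by rw [frobNorm_sub_comm]; exact hU e
  calc frobNorm (((gaugeTransform g U e : SU2) : Matrix (Fin 2) (Fin 2) ℂ) - (U e : Matrix (Fin 2) (Fin 2) ℂ))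
      ≤ frobNorm (((g e.1 * U e * (g (e.1.shift e.2))⁻¹ : SU2) : Matrix (Fin 2) (Fin 2) ℂ) -
            ((c * U e * c⁻¹ : SU2) : Matrix (Fin 2) (Fin 2) ℂ)) +
          frobNorm (((c * U e * c⁻¹ : SU2) : Matrix (Fin 2) (Fin 2) ℂ) - (U e : Matrix (Fin 2) (Fin 2) ℂ)) := frobNorm_sub_le _ _ _
    _ ≤ (t₂ + t₂) + (t₂ + (s + t₂)) := by
        refine add_le_add (h1.trans (add_le_add (hgx _) (hgx _))) ?_
        refine (frobNorm_sub_le _ _ _).trans (add_le_add h2 ?_)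
        exact (frobNorm_sub_le _ _ _).trans (add_le_add h3 h4)
    _ = 4 * t₂ + s := by ring

/-! ## §3 The ring deficit on the nearly-commuting box -/

/-- ★★ **THE RING DEFICIT IS `≤ 250·L⁴·(t₂ + s)²` ON THE NEARLY-COMMUTING BOX.**  Tree-gauge coordinates `(w, (r, g))`, ring history
`(glue w ∷ r, g)`, leaders `C μ = w(−ê_μ, μ)` and `c = g 0` with `‖C_μC_ν − C_νC_μ‖_F ≤ s`, `‖cC_μ − C_μc‖_F ≤ s` (NO smallness of the leaders); every
other off-tree link of slice `0` within `t₂` of its letter, the slices `1…2L−1` within `t₂` of `glue w`, the seam field within `t₂` of `g 0` (all as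
`‖letter⁻¹·X − 1‖_F ≤ t₂`); `0 ≤ t₂, s`.  Through ✓`ringDeficit_eq_sums`: kinetic bonds `≤ 6L³t₂²`, seam bond `≤ 3L³(5t₂ + s)²/2`, Wilson actions
`≤ 3L³(8t₂ + s)²/2`. [cite: Luscher1983, §2] [cite: GonzalezarroyoAltes1988] -/
theorem ringDeficit_le_of_commBox {t₂ s : ℝ} (ht₂ : 0 ≤ t₂) (hs : 0 ≤ s)
    (w : OffIdx L → SU2) (r : Fin (2 * L - 1) → GaugeConfig 3 L SU2) (g : Site 3 L → SU2)
    (hCC : ∀ μ ν : Fin 3,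
      frobNorm (((w ⟨(Pi.single μ (-1 : ZMod L), μ), leader_not_treeEdge μ⟩ * w ⟨(Pi.single ν (-1 : ZMod L), ν), leader_not_treeEdge ν⟩ : SU2) :
          Matrix (Fin 2) (Fin 2) ℂ) -
        ((w ⟨(Pi.single ν (-1 : ZMod L), ν), leader_not_treeEdge ν⟩ * w ⟨(Pi.single μ (-1 : ZMod L), μ), leader_not_treeEdge μ⟩ : SU2) :
          Matrix (Fin 2) (Fin 2) ℂ)) ≤ s)
    (hcC : ∀ μ : Fin 3,
      frobNorm (((g 0 * w ⟨(Pi.single μ (-1 : ZMod L), μ), leader_not_treeEdge μ⟩ : SU2) : Matrix (Fin 2) (Fin 2) ℂ) -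
        ((w ⟨(Pi.single μ (-1 : ZMod L), μ), leader_not_treeEdge μ⟩ * g 0 : SU2) : Matrix (Fin 2) (Fin 2) ℂ)) ≤ s)
    (hw : ∀ i : OffIdx L, frobNorm ((((if i.1.1 i.1.2 = -1 then w ⟨(Pi.single i.1.2 (-1 : ZMod L), i.1.2), leader_not_treeEdge i.1.2⟩
        else 1)⁻¹ * w i : SU2) : Matrix (Fin 2) (Fin 2) ℂ) - 1) ≤ t₂)
    (hr : ∀ (j : Fin (2 * L - 1)) (e : Edge 3 L), frobNorm ((((glue w e)⁻¹ * r j e : SU2) : Matrix (Fin 2) (Fin 2) ℂ) - 1) ≤ t₂)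
    (hg : ∀ x, frobNorm ((((g 0)⁻¹ * g x : SU2) : Matrix (Fin 2) (Fin 2) ℂ) - 1) ≤ t₂) :
    ringDeficit L (fun _ => false) ((Fin.cons (glue w) r : Fin (2 * L - 1 + 1) → GaugeConfig 3 L SU2), g) ≤
      250 * (L : ℝ) ^ 4 * (t₂ + s) ^ 2 := by
  -- abbreviations
  set C : Fin 3 → SU2 := fun μ => w ⟨(Pi.single μ (-1 : ZMod L), μ), leader_not_treeEdge μ⟩ with hCdef
  set ℓ : Edge 3 L → SU2 := fun e => if e.1 e.2 = -1 then C e.2 else 1 with hℓ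
  set P : Fin (2 * L - 1 + 1) → GaugeConfig 3 L SU2 := Fin.cons (glue w) r with hP
  have hL1 : (1 : ℝ) ≤ L := by exact_mod_cast NeZero.one_le
  have hL0 : (0 : ℝ) ≤ (L : ℝ) ^ 3 := by positivity
  have hts : 0 ≤ t₂ + s := add_nonneg ht₂ hs
  have hCC' : ∀ μ ν, frobNorm (((C μ * C ν : SU2) : Matrix (Fin 2) (Fin 2) ℂ) - ((C ν * C μ : SU2) : Matrix (Fin 2) (Fin 2) ℂ)) ≤ s := hCC
  -- the seam value commutes with every letter up to `s`
  have hcℓ : ∀ e, frobNorm (((g 0 * ℓ e : SU2) : Matrix (Fin 2) (Fin 2) ℂ) - ((ℓ e * g 0 : SU2) : Matrix (Fin 2) (Fin 2) ℂ)) ≤ s := by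
    intro e; simp only [hℓ]
    split_ifs
    · exact hcC _
    · rw [mul_one, one_mul, sub_self, frobNorm_zero]; exact hs
  -- slice 0 is `t₂`-close to the letters, linkwise
  have h0ℓ : ∀ e : Edge 3 L, frobNorm (((glue w e : SU2) : Matrix (Fin 2) (Fin 2) ℂ) - (ℓ e : Matrix (Fin 2) (Fin 2) ℂ)) ≤ t₂ := by
    intro e
    by_cases he : treeEdge e = true
    · have hne := apply_ne_neg_one_of_treeEdge he
      rw [glue_apply_of_tree w he]
      simp only [hℓ, if_neg hne, sub_self, frobNorm_zero]
      exact ht₂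
    · rw [glue_apply_of_not_tree w he, ← frobNorm_inv_mul_sub_one]
      exact hw ⟨e, he⟩
  -- every slice is `t₂`-close to slice 0
  have hP0 : ∀ (i : Fin (2 * L - 1 + 1)) (e : Edge 3 L),
      frobNorm ((P i e : Matrix (Fin 2) (Fin 2) ℂ) - ((glue w e : SU2) : Matrix (Fin 2) (Fin 2) ℂ)) ≤ t₂ := by
    intro i e
    refine Fin.cases ?_ (fun j => ?_) i
    · simp only [hP, Fin.cons_zero, sub_self, frobNorm_zero]; exact ht₂
    · simp only [hP, Fin.cons_succ]
      rw [← frobNorm_inv_mul_sub_one]; exact hr j e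
  -- every slice is in the nearly-commuting box of radii `(s, 2t₂)`
  have hPℓ : ∀ (i : Fin (2 * L - 1 + 1)) (e : Edge 3 L),
      frobNorm ((((ℓ e)⁻¹ * P i e : SU2) : Matrix (Fin 2) (Fin 2) ℂ) - 1) ≤ 2 * t₂ := by
    intro i e
    rw [frobNorm_inv_mul_sub_one]
    exact (frobNorm_sub_le _ _ _).trans (by linarith [hP0 i e, h0ℓ e])
  have hS : ∀ i : Fin (2 * L - 1 + 1), wilsonAction su2Rep (P i) ≤ 96 * (L : ℝ) ^ 3 * (t₂ + s) ^ 2 := by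
    intro i
    have h := wilsonAction_le_of_commBox (P i) C hs hCC' (t₂ := 2 * t₂) (fun e => hPℓ i e)
    have hb : (4 * (2 * t₂) + s) ^ 2 / 2 ≤ 32 * (t₂ + s) ^ 2 := by nlinarith [mul_nonneg ht₂ hs, sq_nonneg s, sq_nonneg t₂]
    nlinarith [hb]
  have hSg : wilsonAction su2Rep (gaugeTransform g (P 0)) ≤ 96 * (L : ℝ) ^ 3 * (t₂ + s) ^ 2 := by
    rw [wilsonAction_gaugeTransform]; exact hS 0
  -- kinetic bonds
  have hkin : ∀ i : Fin (2 * L - 1),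
      6 * (L : ℝ) ^ 3 - timeCoupling su2Rep (P i.castSucc) (P i.succ) ≤ 6 * (L : ℝ) ^ 3 * (t₂ + s) ^ 2 := by
    intro i
    have hd : ∀ e, frobNorm ((P i.castSucc e : Matrix (Fin 2) (Fin 2) ℂ) - (P i.succ e : Matrix (Fin 2) (Fin 2) ℂ)) ≤ 2 * t₂ :=
      fun e => (frobNorm_sub_le _ ((glue w e : SU2) : Matrix (Fin 2) (Fin 2) ℂ) _).trans (by
        rw [frobNorm_sub_comm ((glue w e : SU2) : Matrix (Fin 2) (Fin 2) ℂ)]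
        linarith [hP0 i.castSucc e, hP0 i.succ e])
    have h := kinetic_le_of_dist (by positivity) hd
    nlinarith [h, mul_nonneg ht₂ hs, sq_nonneg s]
  -- seam bond
  have hseam : 6 * (L : ℝ) ^ 3 - timeCoupling su2Rep (P (Fin.last (2 * L - 1))) (gaugeTransform g (P 0)) ≤
      3 * (L : ℝ) ^ 3 * ((5 * (t₂ + s)) ^ 2 / 2) := by
    have hP00 : P 0 = glue w := by simp only [hP, Fin.cons_zero]
    have hd : ∀ e, frobNorm ((P (Fin.last (2 * L - 1)) e : Matrix (Fin 2) (Fin 2) ℂ) -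
        ((gaugeTransform g (P 0) e : SU2) : Matrix (Fin 2) (Fin 2) ℂ)) ≤ 5 * (t₂ + s) := by
      intro e
      rw [hP00]
      have h1 := hP0 (Fin.last (2 * L - 1)) e
      have h2 := frobNorm_gaugeTransform_sub_le_of_commSeam ℓ hg hcℓ h0ℓ e
      rw [frobNorm_sub_comm] at h2
      have h3 := frobNorm_sub_le (P (Fin.last (2 * L - 1)) e : Matrix (Fin 2) (Fin 2) ℂ)
        ((glue w e : SU2) : Matrix (Fin 2) (Fin 2) ℂ) ((gaugeTransform g (glue w) e : SU2) : Matrix (Fin 2) (Fin 2) ℂ)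
      linarith [h1, h2, h3]
    exact kinetic_le_of_dist (by positivity) hd
  -- assemble through `ringDeficit_eq_sums`
  rw [ringDeficit_eq_sums, twist3_false]
  dsimp only
  have hcast : ((2 * L - 1 : ℕ) : ℝ) = 2 * (L : ℝ) - 1 := by
    have : 1 ≤ L := NeZero.one_le
    rw [Nat.cast_sub (by omega), Nat.cast_mul]; norm_num
  have hA : ∑ i : Fin (2 * L - 1), (6 * (L : ℝ) ^ 3 - timeCoupling su2Rep (P i.castSucc) (P i.succ)) ≤
      (2 * (L : ℝ) - 1) * (6 * (L : ℝ) ^ 3 * (t₂ + s) ^ 2) := by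
    calc ∑ i : Fin (2 * L - 1), (6 * (L : ℝ) ^ 3 - timeCoupling su2Rep (P i.castSucc) (P i.succ))
        ≤ ∑ _i : Fin (2 * L - 1), 6 * (L : ℝ) ^ 3 * (t₂ + s) ^ 2 := Finset.sum_le_sum fun i _ => hkin i
      _ = (2 * (L : ℝ) - 1) * (6 * (L : ℝ) ^ 3 * (t₂ + s) ^ 2) := by
          rw [Finset.sum_const, Finset.card_univ, Fintype.card_fin, nsmul_eq_mul, hcast]
  have hB : ∑ i : Fin (2 * L - 1), (1 / 2 : ℝ) * (wilsonAction su2Rep (P i.castSucc) + wilsonAction su2Rep (P i.succ)) ≤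
      (2 * (L : ℝ) - 1) * (96 * (L : ℝ) ^ 3 * (t₂ + s) ^ 2) := by
    calc ∑ i : Fin (2 * L - 1), (1 / 2 : ℝ) * (wilsonAction su2Rep (P i.castSucc) + wilsonAction su2Rep (P i.succ))
        ≤ ∑ _i : Fin (2 * L - 1), 96 * (L : ℝ) ^ 3 * (t₂ + s) ^ 2 :=
          Finset.sum_le_sum fun i _ => by linarith [hS i.castSucc, hS i.succ]
      _ = (2 * (L : ℝ) - 1) * (96 * (L : ℝ) ^ 3 * (t₂ + s) ^ 2) := by
          rw [Finset.sum_const, Finset.card_univ, Fintype.card_fin, nsmul_eq_mul, hcast]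
  have hD : (1 / 2 : ℝ) * (wilsonAction su2Rep (P (Fin.last (2 * L - 1))) + wilsonAction su2Rep (gaugeTransform g (P 0))) ≤
      96 * (L : ℝ) ^ 3 * (t₂ + s) ^ 2 := by linarith [hS (Fin.last (2 * L - 1)), hSg]
  have ht0 : 0 ≤ (t₂ + s) ^ 2 := sq_nonneg _
  have hmono : (L : ℝ) ^ 3 * (t₂ + s) ^ 2 ≤ (L : ℝ) ^ 4 * (t₂ + s) ^ 2 := by
    have h := mul_nonneg (mul_nonneg hL0 (sub_nonneg.2 hL1)) ht0
    nlinarith [h]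
  nlinarith [hA, hB, hD, hseam, hmono, mul_nonneg hL0 ht0]

end Summit.QuantumFields.YangMills.Theorems.SwapTwistDeficit.PeriodicRingFloor

end
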